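import Summits.Parity.GeneralizedHardyLittlewood.Theorems.FordMaynardSieveConst01651SieveConst01651CertRangeBounds
import Summits.Parity.GeneralizedHardyLittlewood.Theorems.FordMaynardSieveConst01651SieveConst01651RectBrackets
import HarnessLib

/-!
# Route `FordMaynardSieveConst01651`, target `SieveConst01651` (stmt-Parity-19185), stub `stub_certValuePos` (R2):
# the checker's lookups bound `Φ₆(1 − y₁ − y₂)` on a half-open grid rectangle

Def-free helper file (step (6) of the `certP`/`certN` soundness, see `…CertAssembly`).  On the half-open rectangle
`[u₀/J, u₁/J) × [v₀/J, v₁/J)` (`J = 120000`) the sum `s = y₁ + y₂` ranges in `[(u₀+v₀)/J, (u₁+v₁)/J)`, so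
`x = 1 − s ∈ ((J−u₁−v₁)/J, (J−u₀−v₀)/J]` lies in a grid cell `m ∈ [J−u₁−v₁, J−u₀−v₀)` (`exists_cell_of_mem_Ioc`), and
`…CertRangeBounds.phiSix_range_bounds` gives

  `phiLoRange certBlockLo (J−u₁−v₁) (J−u₀−v₀)/D ≤ Φ₆(1 − y₁ − y₂) ≤ phiHiRange certBlockHi (J−u₁−v₁) (J−u₀−v₀)/D`

(`phiSix_bounds_on_rect`, for `u₁ + v₁ ≤ 60000` and `39616 ≤ u₀ + v₀`) — the pointwise hypotheses of the rectangle
brackets `…RectBrackets` (to be applied on half-open rectangles, whose integrals agree with the closed ones).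

References: folklore.
-/

noncomputable section

open MeasureTheory Set
open scoped Classical
open Literature.NumberTheory.Sieve Literature.NumberTheory.Sieve.FordMaynard
open Literature.Analysis.Convolution

namespace Summit.Parity.GeneralizedHardyLittlewood.FordMaynardSieveConst01651SieveConst01651

/-- A point of `(lo/J, hi/J]` lies in a grid cell `(m/J, (m+1)/J]` with `lo ≤ m < hi`. [folklore] -/
theorem exists_cell_of_mem_Ioc {J : ℝ} (hJ : 0 < J) {lo hi : ℕ} {x : ℝ}
    (hx : x ∈ Set.Ioc ((lo : ℝ) / J) ((hi : ℝ) / J)) :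
    ∃ m : ℕ, lo ≤ m ∧ m < hi ∧ x ∈ Set.Ioc ((m : ℝ) / J) (((m : ℝ) + 1) / J) := by
  obtain ⟨h1, h2⟩ := hx
  have hxJ0 : (lo : ℝ) < x * J := by rwa [div_lt_iff₀ hJ] at h1
  have hxJ1 : x * J ≤ hi := by rwa [le_div_iff₀ hJ] at h2
  have hpos : 0 ≤ x * J := le_trans (by positivity) hxJ0.le
  refine ⟨⌈x * J⌉₊ - 1, ?_, ?_, ?_, ?_⟩
  · have : lo < ⌈x * J⌉₊ := Nat.lt_ceil.2 hxJ0
    omega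
  · have : ⌈x * J⌉₊ ≤ hi := Nat.ceil_le.2 hxJ1
    have h0 : 0 < ⌈x * J⌉₊ := Nat.lt_ceil.2 (by exact_mod_cast lt_of_le_of_lt (Nat.cast_nonneg lo) hxJ0)
    omega
  · have h0 : 0 < ⌈x * J⌉₊ := Nat.lt_ceil.2 (by exact_mod_cast lt_of_le_of_lt (Nat.cast_nonneg lo) hxJ0)
    rw [div_lt_iff₀ hJ, Nat.cast_sub (by omega), Nat.cast_one]
    have := Nat.ceil_lt_add_one hpos
    linarith
  · have h0 : 0 < ⌈x * J⌉₊ := Nat.lt_ceil.2 (by exact_mod_cast lt_of_le_of_lt (Nat.cast_nonneg lo) hxJ0)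
    rw [le_div_iff₀ hJ, Nat.cast_sub (by omega), Nat.cast_one, sub_add_cancel]
    exact Nat.le_ceil _

/-- **The lookups bound `Φ₆(1 − y₁ − y₂)` on a half-open grid rectangle** (`u₁ + v₁ ≤ 60000`, `39616 ≤ u₀ + v₀`,
`u₀ ≤ u₁`, `v₀ ≤ v₁`). [folklore] -/
theorem phiSix_bounds_on_rect {u₀ u₁ v₀ v₁ : ℕ} (hu : u₀ ≤ u₁) (hv : v₀ ≤ v₁) (hhi : u₁ + v₁ ≤ 60000)
    (hlo : 39616 ≤ u₀ + v₀) {y : ℝ × ℝ}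
    (hy : y ∈ Set.Ico ((u₀ : ℝ) / tabJ) ((u₁ : ℝ) / tabJ) ×ˢ Set.Ico ((v₀ : ℝ) / tabJ) ((v₁ : ℝ) / tabJ)) :
    ((phiLoRange certBlockLo (tabJ - u₁ - v₁) (tabJ - u₀ - v₀) : ℕ) : ℝ) / tabD ≤
        ∑ k ∈ Finset.Icc 1 6, (1 / (k.factorial : ℝ)) *
          cpow (fun t : ℝ => if (1651 / 10000 : ℝ) < t then 1 / t else 0) k (1 - (y.1 + y.2)) ∧
      ∑ k ∈ Finset.Icc 1 6, (1 / (k.factorial : ℝ)) *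
          cpow (fun t : ℝ => if (1651 / 10000 : ℝ) < t then 1 / t else 0) k (1 - (y.1 + y.2)) ≤
        ((phiHiRange certBlockHi (tabJ - u₁ - v₁) (tabJ - u₀ - v₀) : ℕ) : ℝ) / tabD := by
  have hJ : (tabJ : ℝ) = 120000 := by norm_num [tabJ]
  have hJpos : (0 : ℝ) < tabJ := by rw [hJ]; norm_num
  obtain ⟨⟨hy1a, hy1b⟩, ⟨hy2a, hy2b⟩⟩ := hy
  -- `x = 1 − (y₁ + y₂)` lies in `((J−u₁−v₁)/J, (J−u₀−v₀)/J]`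
  have hx : 1 - (y.1 + y.2) ∈ Set.Ioc ((((tabJ - u₁ - v₁ : ℕ) : ℝ)) / tabJ) ((((tabJ - u₀ - v₀ : ℕ) : ℝ)) / tabJ) := by
    have e1 : ((tabJ - u₁ - v₁ : ℕ) : ℝ) = (tabJ : ℝ) - u₁ - v₁ := by
      rw [Nat.cast_sub (by norm_num [tabJ]; omega), Nat.cast_sub (by norm_num [tabJ]; omega)]
    have e2 : ((tabJ - u₀ - v₀ : ℕ) : ℝ) = (tabJ : ℝ) - u₀ - v₀ := by
      rw [Nat.cast_sub (by norm_num [tabJ]; omega), Nat.cast_sub (by norm_num [tabJ]; omega)]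
    rw [e1, e2]
    constructor
    · rw [div_lt_iff₀ hJpos]
      rw [lt_div_iff₀ hJpos] at hy1b hy2b
      nlinarith
    · rw [le_div_iff₀ hJpos]
      rw [div_le_iff₀ hJpos] at hy1a hy2a
      nlinarith
  obtain ⟨m, hm1, hm2, hmx⟩ := exists_cell_of_mem_Ioc hJpos hx
  exact phiSix_range_bounds (by norm_num [tabJ]; omega) (by norm_num [tabJ]; omega) hm1 hm2 hmx

end Summit.Parity.GeneralizedHardyLittlewood.FordMaynardSieveConst01651SieveConst01651

end
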